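import Literature.MathematicalPhysics.QuantumFieldTheory.Balaban1983to89.B6Prop26KLevelAssemblyV1PerCubeL0
import Literature.MathematicalPhysics.QuantumFieldTheory.Balaban1983to89.B6Prop26KLevelAssemblyV1PerCubeL3
import Literature.MathematicalPhysics.QuantumFieldTheory.Balaban1983to89.B6PadLevelV1L0
import Literature.MathematicalPhysics.QuantumFieldTheory.Balaban1983to89.B6PadLevelV1L3
import Literature.MathematicalPhysics.QuantumFieldTheory.Balaban1983to89.B6Prop26KLevelAssemblyPadV1
/-!
# `Balaban1983to89.B6Prop26KLevelAssemblyPadV1L3` — RE-CENTRED-WINDOW TWIN (sub-row G-F3′-L0∕L3 of programme G-F3′-L0; UV3-NODE §26.3 (P2-L3); every odd `L ≥ 3`;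
ruling of record `lit-balaban-r03/G-F3L0-PLAN.md` v1.5 §13 (B′), joints J9′–J11′, J14) of `B6Prop26KLevelAssemblyPadV1L0`: the SAME declarations, names and
statements over p21's re-centred root `B6CubeWindowV1L3` (window corner `x0C = S_j·(qc − ℓ) = ctr − (2L−1)S_j/2` — the cube's central block is
the middle block of its `2L`-block member torus, print p.238 «□ in the middle of □̃³ = T_□»; reach sub-window corner `x1C = x0C + (L−2)S_j`;
`PlacedC`; `eC`, `ρ`, `R ≥ 2L²`, `C = 9`, `M_c = 8S/3` UNCHANGED; the binder `(4 ≤ ℓ)` DROPPED).  J14: ONLY the window-dependent declarations are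
re-declared here; every window-free declaration of the L0 twin and every `D`-free object of the lineage is consumed BY NAME.  No existing module is
touched; no fact is minted; standard axioms.  Unit `lit-balaban-p33` (gen 90), 2026-08-27.  THE TWIN'S DOCUMENTATION FOLLOWS VERBATIM (its
«x₀ = ctr − L·S_j/2» / «L ≥ 5» sentences describe the twin; here the anchor is `(2L−1)S_j/2` and L ≥ 3; the twin's `…_L5` conveniences
(L = 5, P′ ≥ 12, `placed_all_cubes`) become `…_L3` ones (L = 3, P′ ≥ 6) through p21's `B6CubeWindowV1L3.placedC_all_cubes (ℓ = 2) (6 ≤ P′)`).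

statement-level skeleton of published theorems with citation tags; proofs where landed; nothing here is a claim about the Yang–Mills mass gap

# `Balaban1983to89.B6Prop26KLevelAssemblyPadV1L0` — LEVEL-0 TWIN (programme G-F3′-L0, director-ym LINE №27 / UV3-NODE §24.5; plan `lit-balaban-r03/G-F3L0-PLAN.md`) of `B6Prop26KLevelAssemblyPadV1`:
the same declarations, SAME NAMES AND STATEMENTS, for nested families WITH print's region `Λ₀ = T ∖ Ω₁` ADMITTED (structures
`B6MultiLevelBoxOperatorL0.Domains` / `B6MultiLevelTorusOperatorL0.TDomains`: levels `0, …, k`, the level-`0` block a single site, `Q′₀ = id`,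
finite weight `a₀` — print p.225 (2.14) «Σ_{j=0}^k … (Q′₀λ)(x) = λ(x), x ∈ Λ₀», p.229 «taking a sequence (2.1) … smallest possible domains B^j(Λ_j),
and considering the operator Δ_a defined by (2.19), (2.20) for this sequence»).  Every `D`-free object is the lineage's, consumed BY NAME; no existing
module is touched; no fact is minted.  Unit `lit-balaban-p33` (p33 gen 89; S-E entry twins named to p33 by the B6 owner r03 gen 36, ruling 2026-08-27T18:45:57Z; port tooling by r03 gen 36); B6 fold owner r03; referee ref-4.  THE TWIN'S DOCUMENTATION FOLLOWS
VERBATIM (its «levels 1 … k» / «Ω₁ = X» sentences describe the twin; here `j` runs from `0` and `Ω₁` may be a proper subset).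

# `Balaban1983to89.B6Prop26KLevelAssemblyPadV1` — T. Bałaban, *Propagators and renormalization transformations for lattice gauge theories. II*,
# Commun. Math. Phys. **96** (1984) 223–250 [Balaban1984PropagatorsII], Prop. 2.6 (2.136)₁ p. 247 for the GENUINE `k`-level `G = Δ_a⁻¹` on the V1
# torus FOR EVERY ODD `L ≥ 5` — the placement hypothesis of r03's assembly DISCHARGED BY LEVEL PADDING (`…B6PadLevelV1`): the cubes of the padded
# family `padT D` (one more, empty, level) all lie below its top level, so r03's `placedC_of_lt` places every one of them, and the conclusion for the
# padded family IS the conclusion for `D` (`SameOm.GE_eq`: the same `G`; `hasMajorant_of_pad`, `dist_eT`, `pref_eT`: the same blocks and distance)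

statement-level skeleton of published theorems with citation tags; proofs where landed; nothing here is a claim about the Yang–Mills mass gap

PDF held: `paper:balaban1984-cmp96-propagators-rt-ii` (journal page = PDF page + 222): p. 247 [PDF 25] ((2.133)–(2.136), Prop. 2.6), p. 224 [PDF 2]
((2.1)–(2.4), *"we admit the case when some domains Ω_j are equal to T_η"*), p. 229 [PDF 7] ((2.36)), p. 238–239 [PDF 16–17] ((2.88)–(2.94)); read
from the tree transcriptions in the imported modules.

CITATION HEADER (lean-in-tree rule) — WHAT IS REPRODUCED.  Phase-2 file of the `lit-balaban` typed skeleton (HOME `run/shared/lean/pub/lit-balaban/`), seat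
**p38 gen 29** (literature-prover-lit-balaban-p38-g29-0) for the row owner r03's (R6) of B6-CLOSURE §5 item 15 («general-L top-cube placement via `ccAt`
(L = 5 ∧ P′ ≥ 12 is automatic)»); SKELETON rows **B6.Prop2.6** × B6.Eq2.134 × B6.Eq2.36 (cells only; decls of record untouched; referee ref-4).  IMPORTS BY
NAME, restating nothing: `…B6Prop26KLevelAssemblyV1PerCube` (p38 g29: `prop26_2136_kLevel_assembly_line3` — r03's `prop26_2136_kLevel_assembly_nbig` with
(ii) `hMout` and (iii) the line-1 sizes/supports discharged), `…B6Prop26KLevelAssemblyV1` (r03 g21 v1.4: `prop26_2136_kLevel_final_le`, the rate a parameter), `…B6PadLevelV1` (p38 g29: `padT`, `hN_pad`, `placed_pad`, `sameOm_domT_pad`, `SameOm.GE_eq`,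
`SameOm.idxB`, `eT`, `dist_eT`, `pref_eT`, `hasMajorant_of_pad`, `globalBand_pad`).

## WHAT THIS FILE CERTIFIES (kernel-checked, 0 sorry, standard axioms; THEOREMS ONLY — no `def`, no `def … : Prop`, no new named fact)

**`prop26_2136_kLevel_assembly_pad_line3`** (fixed rate) and **`prop26_2136_kLevel_final_pad_le`** (r03's rate-parametric `prop26_2136_kLevel_final_le`,
`σ ≤ σ₀`, at the padded family) — PROPOSITION 2.6, ENTRY (2.136)₁, FOR THE GENUINE k-LEVEL `G = GE (domT hN D hk)` ON THE V1 TORUS, EVERY ODD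
`L ≥ 5`, NO PLACEMENT HYPOTHESIS: for the weight band `[b₀, b₁]` there is `σ > 0`; for every Lemma-2.1 budget `(α, N₀)` and line-3 constants `C_D ≥ 0`,
`c_D > 0` there are `A ≥ 0`, `M₁ > 0` such that — on every V1 torus (`hN`, p21's `D`, `k ≥ 1`, `k + 1 ≤ m + K`, `M_h = L^a ≥ 8`, `R ≥ 2L²`, `L ≥ 5`,
`P′ = L·P″` with `P″ ≥ 5`, `L·M_h ≥ M₁`, `N₀ + 1 ≤ R·L·M_h`, the (2.59)-shape threshold), for `c′ ≠ 0` and weights in the global band, GIVEN the line-3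
majorant (iv) for the members of the cubes of the PADDED family `padT D` (all placed: `placed_pad`; its level-`< k` members are those of `D` verbatim, its
level-`k` members are the top cubes of `D` charted at `S_k`-index `∈ [2L, 3L)`) — `HasMajorant (geomT D) (blkV1 hN D) G (A·(L^{j(y)}/c′)²·e^{−δ₃ d_T(y,y′)})`,
`δ₃ = delta3 α (2σ)`.  Proof: `prop26_2136_kLevel_assembly_line3` applied to `padT D` (`k + 1` levels, all cubes placed, weights `w ∘ idxB`), then
`SameOm.GE_eq` (the padded family has LITERALLY the same `G`) and `hasMajorant_of_pad` + `dist_eT` + `pref_eT` (the same blocks, block map, distance (2.46)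
and prefactor).  v1.1 (§3): **`prop26_2136_kLevel_final_pad_M`** / **`prop26_2136_kLevel_final_pad_M_V1`** — the same from r03's v1.5 `prop26_2136_kLevel_final_M`
(for `α > 0` the Lemma-2.1 exponent `N₀` is chosen inside; ONE size threshold `M₂ ≤ L·M_h` remains), at the padded family resp. on the original data.

## HONEST SCOPE / DIVERGENCES

(1) Displayed: the line-3 majorant (iv) (p38/p22 by-parts route, in progress) — stated for the cubes/members of `padT D` (whoever proves (iv) for every
admissible torus family proves it for `padT D`), and the Lemma-2.1 budget.  (2) `P′ = L·P″`, `P″ ≥ 5`, `k + 1 ≤ m + K`: in the V1 setting `N₀ = 2L^{m+K}`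
forces `P′ ∈ {2L^n}`, so these hold as soon as `P′ ≥ 5L` (print: the torus is as large as needed); `k ≥ 1` (for `k = 1` the padded family has the two
levels the assembly wants).  (3) `L ≥ 5` remains (the band lemma of `B6CubeInDecayV1`; `L = 3` needs the re-centred window) — what is removed here is the
restriction `L ≤ 5` of `placedC_top`, i.e. the k-level (2.136)₁ now holds for EVERY odd `L ≥ 5` modulo line 3.  (4) Constants `A`, `M₁` on `d, L, b₀, b₁, α, N₀,
C_D, c_D` only.  (5) Entries (2.136)₂₋₄ / (2.137)–(2.140) untouched; integer torus; nothing on d = 4 or the continuum; NOT summit progress.  Unit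
`lit-balaban-p38` (gen 29), 2026-08-23.
-/

open scoped BigOperators
open Finset

namespace Literature.MathematicalPhysics.QuantumFieldTheory.Balaban1983to89.B6Prop26KLevelAssemblyPadV1L3

open B4Reflection242 (boxDom)
open B6MultiLevelBoxOperator (N0)
open B6MultiLevelTorusOperatorL0 (TDomains)
open B6Cover236MultiLevelBlocksL0 (cubes)
open B6Geom246MultiLevelTorusL0 (geomT)
open B8Ineq192MultiLevelTorusL0 (geomTB)
open B6RandomWalk (HasMajorant delta3)
open B6Prop26Gluing (mulOp)
open B6Ineq2133TwoScaleV1 (onFun)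
open B6GlobalChartV1 (PV)
open B6GlobalChartV1L0 (domT blkV1)
open B6SectAOperatorsV1 (dE dsE RE BondIdx)
open B6SectAVectorModelV1 (GE)
open B6Prop26KLevelSkeletonV1L0 (hB zB pref)
open B6CubeWindowV1 (GlobalBand band_le one_le_of_eight_le four_le_of_five_le)
open B6CubeWindowV1L3 (Pl)
open B6Prop26KLevelAssemblyV1L3 (prop26_2136_kLevel_final_le)
open B6Prop26KLevelAssemblyV1PerCubeL3 (prop26_2136_kLevel_assembly_line3)
open B6PadLevelV1 (hN_pad SameOm.idxB SameOm.GE_eq)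
open B6PadLevelV1L3 (placed_pad)
open B6PadLevelV1L0 (padT sameOm_domT_pad eT dist_eT pref_eT hasMajorant_of_pad globalBand_pad)
open Literature.MathematicalPhysics.QuantumFieldTheory.Balaban1983to89.B6Prop26KLevelAssemblyPadV1 (P'_mul_pow_eq three_le_L akle_of_V1 P'_eq_of_V1 hLP_of_V1 hP5_of_V1 hk'_of_V1)

noncomputable section

variable {d ℓ : ℕ} {hd : 1 ≤ d + 1} {hL : Odd (ℓ + 1) ∧ 1 < ℓ + 1} {m K : ℕ} {Mh k R : ℕ} {P' P'' : Fin (d + 1) → ℕ}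

/-! ## §1  The k-level (2.136)₁ for every odd `L ≥ 5`: placement discharged by padding -/

section Pad

open Classical in
/-- **PROPOSITION 2.6, ENTRY (2.136)₁, FOR THE GENUINE k-LEVEL `G = Δ_a⁻¹` ON THE V1 TORUS, EVERY ODD `L ≥ 5`, ONLY LINE 3 DISPLAYED.**  The placement
hypothesis of r03's assembly (all cubes `PlacedC`, automatic only for `L = 5`) is DISCHARGED by padding the torus family with one empty level (`padT D`,
`P′ = L·P″`): every cube of the padded cover lies below its top level (`placed_pad`), the padded family has the same `Λ_j`, `𝔅`, `Δ_a`, `G` (`SameOm.GE_eq`)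
and the same blocks and distance (2.46) (`hasMajorant_of_pad`, `dist_eT`, `pref_eT`).  Displayed: the line-3 majorant (iv) for the members of the cubes of
`padT D` (weights `w ∘ idxB`) and the Lemma-2.1 budget; conclusion: `|G(x,x′)| ≤ A·(L^{j(y)}/c′)²·e^{−δ₃ d_T(y,y′)}` blockwise for the genuine
`G = GE (domT hN D hk)`, `δ₃ = delta3 α (2σ)`.
[cite: Balaban1984PropagatorsII, Prop. 2.6 (2.136) p.247, (2.133)–(2.135) p.247, (2.88)–(2.94) pp.238–239, (2.36) p.229, (2.1)–(2.4) p.224, Lemma 2.1 p.234] -/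
theorem prop26_2136_kLevel_assembly_pad_line3 (d ℓ : ℕ) (hd : 1 ≤ d + 1) (hL : Odd (ℓ + 1) ∧ 1 < ℓ + 1) {b₀ b₁ : ℝ} (hb₀ : 0 < b₀) (hb₁ : b₀ ≤ b₁) :
    ∃ σ : ℝ, 0 < σ ∧ ∀ (α : ℝ), 0 ≤ α → α ≤ 1 → ∀ (N₀ : ℕ), 0 < N₀ → ∀ {CD cD : ℝ}, 0 ≤ CD → 0 < cD →
    ∃ A M₁ : ℝ, 0 ≤ A ∧ 0 < M₁ ∧
    ∀ (m K : ℕ) {Mh k R : ℕ} {P' P'' : Fin (d + 1) → ℕ}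
      (hN : ∀ μ, N0 ℓ Mh k P' μ = (PV d ℓ m K hd hL).sitesPerDir 0) (D : B6MultiLevelTorusOperatorL0.TDomains d ℓ Mh k P' R) (hk : k ≤ m + K) (hk' : k + 1 ≤ m + K) (_ : 1 ≤ k)
      {a : ℕ} (hMha : Mh = (ℓ + 1) ^ a) (hM8 : 8 ≤ Mh) (_ : 2 * (ℓ + 1) ^ 2 ≤ R)
      (hLP : ∀ μ, P' μ = (ℓ + 1) * P'' μ) (hP5 : ∀ μ, 5 ≤ P'' μ)
      (_ : M₁ ≤ ((ℓ : ℝ) + 1) * Mh) (_ : N₀ + 1 ≤ R * ((ℓ + 1) * Mh))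
      (_ : Real.exp (-(α * σ)) * ((ℓ : ℝ) + 1) ^ ((2 * (d + 1 : ℕ) : ℝ) / N₀) < 1)
      {cf : ℝ} (hcf : cf ≠ 0) {w : BondIdx (domT hN D hk) → ℝ} (hw : ∀ i, 0 < w i) (_ : GlobalBand b₀ b₁ cf w)
      -- line 3 (p38/p22) for the members of the cubes of the PADDED family (every cube placed: `placed_pad`)
      (_ : ∀ c : ↥(cubes (padT D hLP).toDomains), HasMajorant (g := geomTB (padT D hLP)) (blkV1 (hN_pad hN hLP) (padT D hLP))
        (mulOp (zB (hN_pad hN hLP) (padT D hLP) (one_le_of_eight_le hM8) (four_le_of_five_le hP5) c) *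
          (onFun (dE (P := PV d ℓ m K hd hL) cf ∘ₗ (LinearMap.id - RE (domT (hN_pad hN hLP) (padT D hLP) hk') cf) ∘ₗ dsE cf) -
            Pl (hN_pad hN hLP) hk' (one_le_of_eight_le hM8) (four_le_of_five_le hP5) hMha c (band_le (d := d) (ℓ := ℓ) hb₀ hb₁)
              (placed_pad D hLP hP5 c) (w ∘ (sameOm_domT_pad hN D hk hLP hk').idxB) cf) *
          mulOp (hB (hN_pad hN hLP) (padT D hLP) c))
        (fun y y'' => CD * cf ^ 2 * Real.exp (-(cD * (geomTB (padT D hLP)).M)) / (geomTB (padT D hLP)).len y ^ 2 *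
          Real.exp (-((2 * σ) * (geomTB (padT D hLP)).dist y y'')))),
      HasMajorant (g := geomT D) (blkV1 hN D) (onFun (GE (domT hN D hk) hcf hw))
        (fun y y' => A * pref cf y * Real.exp (-(delta3 α (2 * σ) * (geomT D).dist y y'))) := by
  obtain ⟨σ, hσ, h⟩ := prop26_2136_kLevel_assembly_line3 d ℓ hd hL hb₀ hb₁
  refine ⟨σ, hσ, fun α hα0 hα1 N₀ hN₀ CD cD hCD hcD => ?_⟩
  obtain ⟨A, M₁, hA, hM₁, h2⟩ := h α hα0 hα1 N₀ hN₀ hCD hcD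
  refine ⟨A, M₁, hA, hM₁, ?_⟩
  intro m K Mh k R P' P'' hN D hk hk' hk1 a hMha hM8 hR2 hLP hP5 hLM hRM hθ cf hcf w hw hwb hD3
  have hS := sameOm_domT_pad hN D hk hLP hk'
  have hw' : ∀ i, 0 < (w ∘ hS.idxB) i := fun i => hw _
  -- the assembly for the padded family (k + 1 levels, every cube placed)
  have hpad := h2 m K (hN_pad hN hLP) (padT D hLP) hk' (by omega) hMha hM8 hR2 hP5 (placed_pad D hLP hP5) hLM hRM hθ hcf hw'
    (globalBand_pad D hLP hN hk hk' hwb) hD3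
  -- the padded family has literally the same `G`
  rw [hS.GE_eq hcf hw hw'] at hpad
  -- the same blocks, block map, distance and prefactor
  have hK : (fun a b : (geomT D).Site => A * pref cf (D := padT D hLP) (eT D hLP a) *
      Real.exp (-(delta3 α (2 * σ) * (geomT (padT D hLP)).dist (eT D hLP a) (eT D hLP b)))) =
      fun y y' => A * pref cf y * Real.exp (-(delta3 α (2 * σ) * (geomT D).dist y y')) := by
    funext a b
    rw [dist_eT, pref_eT]
  rw [← hK]
  exact hasMajorant_of_pad D hLP hN hpad

open Classical in
/-- **THE SAME WITH THE RATE AS A PARAMETER** — r03's `prop26_2136_kLevel_final_le` (`∃ σ₀ > 0, ∀ σ ∈ (0, σ₀], …`: a line-3 majorant proved at its own rate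
`ρ₃` is consumed at `σ := min σ₀ (ρ₃/2)`) at the padded family: every odd `L ≥ 5`, no placement hypothesis, only the line-3 majorant (iv) displayed.
[cite: Balaban1984PropagatorsII, Prop. 2.6 (2.136) p.247, (2.133)–(2.135) p.247, (2.88)–(2.94) pp.238–239, (2.36) p.229, (2.1)–(2.4) p.224, Lemma 2.1 p.234] -/
theorem prop26_2136_kLevel_final_pad_le (d ℓ : ℕ) (hd : 1 ≤ d + 1) (hL : Odd (ℓ + 1) ∧ 1 < ℓ + 1) {b₀ b₁ : ℝ} (hb₀ : 0 < b₀) (hb₁ : b₀ ≤ b₁) :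
    ∃ σ₀ : ℝ, 0 < σ₀ ∧ ∀ (σ : ℝ), 0 < σ → σ ≤ σ₀ → ∀ (α : ℝ), 0 ≤ α → α ≤ 1 → ∀ (N₀ : ℕ), 0 < N₀ → ∀ {CD cD : ℝ}, 0 ≤ CD → 0 < cD →
    ∃ A M₁ : ℝ, 0 ≤ A ∧ 0 < M₁ ∧
    ∀ (m K : ℕ) {Mh k R : ℕ} {P' P'' : Fin (d + 1) → ℕ}
      (hN : ∀ μ, N0 ℓ Mh k P' μ = (PV d ℓ m K hd hL).sitesPerDir 0) (D : B6MultiLevelTorusOperatorL0.TDomains d ℓ Mh k P' R) (hk : k ≤ m + K) (hk' : k + 1 ≤ m + K) (_ : 1 ≤ k)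
      {a : ℕ} (hMha : Mh = (ℓ + 1) ^ a) (hM8 : 8 ≤ Mh) (_ : 2 * (ℓ + 1) ^ 2 ≤ R)
      (hLP : ∀ μ, P' μ = (ℓ + 1) * P'' μ) (hP5 : ∀ μ, 5 ≤ P'' μ)
      (_ : M₁ ≤ ((ℓ : ℝ) + 1) * Mh) (_ : N₀ + 1 ≤ R * ((ℓ + 1) * Mh))
      (_ : Real.exp (-(α * σ)) * ((ℓ : ℝ) + 1) ^ ((2 * (d + 1 : ℕ) : ℝ) / N₀) < 1)
      {cf : ℝ} (hcf : cf ≠ 0) {w : BondIdx (domT hN D hk) → ℝ} (hw : ∀ i, 0 < w i) (_ : GlobalBand b₀ b₁ cf w)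
      (_ : ∀ c : ↥(cubes (padT D hLP).toDomains), HasMajorant (g := geomTB (padT D hLP)) (blkV1 (hN_pad hN hLP) (padT D hLP))
        (mulOp (zB (hN_pad hN hLP) (padT D hLP) (one_le_of_eight_le hM8) (four_le_of_five_le hP5) c) *
          (onFun (dE (P := PV d ℓ m K hd hL) cf ∘ₗ (LinearMap.id - RE (domT (hN_pad hN hLP) (padT D hLP) hk') cf) ∘ₗ dsE cf) -
            Pl (hN_pad hN hLP) hk' (one_le_of_eight_le hM8) (four_le_of_five_le hP5) hMha c (band_le (d := d) (ℓ := ℓ) hb₀ hb₁)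
              (placed_pad D hLP hP5 c) (w ∘ (sameOm_domT_pad hN D hk hLP hk').idxB) cf) *
          mulOp (hB (hN_pad hN hLP) (padT D hLP) c))
        (fun y y'' => CD * cf ^ 2 * Real.exp (-(cD * (geomTB (padT D hLP)).M)) / (geomTB (padT D hLP)).len y ^ 2 *
          Real.exp (-((2 * σ) * (geomTB (padT D hLP)).dist y y'')))),
      HasMajorant (g := geomT D) (blkV1 hN D) (onFun (GE (domT hN D hk) hcf hw))
        (fun y y' => A * pref cf y * Real.exp (-(delta3 α (2 * σ) * (geomT D).dist y y'))) := by
  obtain ⟨σ₀, hσ₀, h⟩ := prop26_2136_kLevel_final_le d ℓ hd hL hb₀ hb₁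
  refine ⟨σ₀, hσ₀, fun σ hσ0 hσle α hα0 hα1 N₀ hN₀ CD cD hCD hcD => ?_⟩
  obtain ⟨A, M₁, hA, hM₁, h2⟩ := h σ hσ0 hσle α hα0 hα1 N₀ hN₀ hCD hcD
  refine ⟨A, M₁, hA, hM₁, ?_⟩
  intro m K Mh k R P' P'' hN D hk hk' hk1 a hMha hM8 hR2 hLP hP5 hLM hRM hθ cf hcf w hw hwb hD3
  have hS := sameOm_domT_pad hN D hk hLP hk'
  have hw' : ∀ i, 0 < (w ∘ hS.idxB) i := fun i => hw _
  have hpad := h2 m K (hN_pad hN hLP) (padT D hLP) hk' (by omega) hMha hM8 hR2 hP5 (placed_pad D hLP hP5) hLM hRM hθ hcf hw'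
    (globalBand_pad D hLP hN hk hk' hwb) hD3
  rw [hS.GE_eq hcf hw hw'] at hpad
  have hK : (fun a b : (geomT D).Site => A * pref cf (D := padT D hLP) (eT D hLP a) *
      Real.exp (-(delta3 α (2 * σ) * (geomT (padT D hLP)).dist (eT D hLP a) (eT D hLP b)))) =
      fun y y' => A * pref cf y * Real.exp (-(delta3 α (2 * σ) * (geomT D).dist y y')) := by
    funext a b
    rw [dist_eT, pref_eT]
  rw [← hK]
  exact hasMajorant_of_pad D hLP hN hpad

end Pad

/-! ## §2  The V1 arithmetic: `N₀ = 2L^{m+K}` forces `P′ = 2L^n`, so `P′ ≥ 5L` gives the padding data -/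

section V1Arith

variable {a : ℕ}

open Classical in
/-- **PROPOSITION 2.6 (2.136)₁ AT k LEVELS, EVERY ODD `L ≥ 5`, STATED ON THE ORIGINAL DATA**: `prop26_2136_kLevel_final_pad_le` with the padding data
`P″ := P′/L`, `P′ = L·P″`, `P″ ≥ 5`, `k + 1 ≤ m + K` DERIVED from `hN`, `M_h = L^a` and `P′_μ ≥ 5L` (`hLP_of_V1`, `hP5_of_V1`, `hk'_of_V1`) — hypotheses: the
torus (`hN`, `D`, `hk`, `k ≥ 1`, `M_h = L^a ≥ 8`, `R ≥ 2L²`, `P′ ≥ 5L`, `L ≥ 5`, `L·M_h ≥ M₁`, budget), `c′ ≠ 0`, the weight band, and the line-3 majorant (iv)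
for the members of the padded family; conclusion: (2.136)₁ for the genuine `G`, rate `delta3 α (2σ)`, any `σ ≤ σ₀`.
[cite: Balaban1984PropagatorsII, Prop. 2.6 (2.136) p.247, (2.133)–(2.135) p.247, (2.88)–(2.94) pp.238–239, (2.36) p.229, (2.1)–(2.4) p.224, Lemma 2.1 p.234] -/
theorem prop26_2136_kLevel_final_pad_le_V1 (d ℓ : ℕ) (hd : 1 ≤ d + 1) (hL : Odd (ℓ + 1) ∧ 1 < ℓ + 1) {b₀ b₁ : ℝ} (hb₀ : 0 < b₀) (hb₁ : b₀ ≤ b₁) :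
    ∃ σ₀ : ℝ, 0 < σ₀ ∧ ∀ (σ : ℝ), 0 < σ → σ ≤ σ₀ → ∀ (α : ℝ), 0 ≤ α → α ≤ 1 → ∀ (N₀ : ℕ), 0 < N₀ → ∀ {CD cD : ℝ}, 0 ≤ CD → 0 < cD →
    ∃ A M₁ : ℝ, 0 ≤ A ∧ 0 < M₁ ∧
    ∀ (m K : ℕ) {Mh k R : ℕ} {P' : Fin (d + 1) → ℕ}
      (hN : ∀ μ, N0 ℓ Mh k P' μ = (PV d ℓ m K hd hL).sitesPerDir 0) (D : B6MultiLevelTorusOperatorL0.TDomains d ℓ Mh k P' R) (hk : k ≤ m + K) (_ : 1 ≤ k)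
      {a : ℕ} (hMha : Mh = (ℓ + 1) ^ a) (hM8 : 8 ≤ Mh) (_ : 2 * (ℓ + 1) ^ 2 ≤ R) (hP : ∀ μ, 5 * (ℓ + 1) ≤ P' μ)
      (_ : M₁ ≤ ((ℓ : ℝ) + 1) * Mh) (_ : N₀ + 1 ≤ R * ((ℓ + 1) * Mh))
      (_ : Real.exp (-(α * σ)) * ((ℓ : ℝ) + 1) ^ ((2 * (d + 1 : ℕ) : ℝ) / N₀) < 1)
      {cf : ℝ} (hcf : cf ≠ 0) {w : BondIdx (domT hN D hk) → ℝ} (hw : ∀ i, 0 < w i) (_ : GlobalBand b₀ b₁ cf w)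
      (_ : ∀ c : ↥(cubes (padT D (hLP_of_V1 hN hMha hP)).toDomains),
        HasMajorant (g := geomTB (padT D (hLP_of_V1 hN hMha hP))) (blkV1 (hN_pad hN (hLP_of_V1 hN hMha hP)) (padT D (hLP_of_V1 hN hMha hP)))
        (mulOp (zB (hN_pad hN (hLP_of_V1 hN hMha hP)) (padT D (hLP_of_V1 hN hMha hP)) (one_le_of_eight_le hM8)
            (four_le_of_five_le (hP5_of_V1 hP)) c) *
          (onFun (dE (P := PV d ℓ m K hd hL) cf ∘ₗ
              (LinearMap.id - RE (domT (hN_pad hN (hLP_of_V1 hN hMha hP)) (padT D (hLP_of_V1 hN hMha hP)) (hk'_of_V1 hN hMha hP)) cf) ∘ₗ dsE cf) -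
            Pl (hN_pad hN (hLP_of_V1 hN hMha hP)) (hk'_of_V1 hN hMha hP) (one_le_of_eight_le hM8) (four_le_of_five_le (hP5_of_V1 hP)) hMha c
              (band_le (d := d) (ℓ := ℓ) hb₀ hb₁) (placed_pad D (hLP_of_V1 hN hMha hP) (hP5_of_V1 hP) c)
              (w ∘ (sameOm_domT_pad hN D hk (hLP_of_V1 hN hMha hP) (hk'_of_V1 hN hMha hP)).idxB) cf) *
          mulOp (hB (hN_pad hN (hLP_of_V1 hN hMha hP)) (padT D (hLP_of_V1 hN hMha hP)) c))
        (fun y y'' => CD * cf ^ 2 * Real.exp (-(cD * (geomTB (padT D (hLP_of_V1 hN hMha hP))).M)) /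
          (geomTB (padT D (hLP_of_V1 hN hMha hP))).len y ^ 2 * Real.exp (-((2 * σ) * (geomTB (padT D (hLP_of_V1 hN hMha hP))).dist y y'')))),
      HasMajorant (g := geomT D) (blkV1 hN D) (onFun (GE (domT hN D hk) hcf hw))
        (fun y y' => A * pref cf y * Real.exp (-(delta3 α (2 * σ) * (geomT D).dist y y'))) := by
  obtain ⟨σ₀, hσ₀, h⟩ := prop26_2136_kLevel_final_pad_le d ℓ hd hL hb₀ hb₁
  refine ⟨σ₀, hσ₀, fun σ hσ0 hσle α hα0 hα1 N₀ hN₀ CD cD hCD hcD => ?_⟩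
  obtain ⟨A, M₁, hA, hM₁, h2⟩ := h σ hσ0 hσle α hα0 hα1 N₀ hN₀ hCD hcD
  refine ⟨A, M₁, hA, hM₁, ?_⟩
  intro m K Mh k R P' hN D hk hk1 a hMha hM8 hR2 hP hLM hRM hθ cf hcf w hw hwb hD3
  exact h2 m K hN D hk (hk'_of_V1 hN hMha hP) hk1 hMha hM8 hR2 (hLP_of_V1 hN hMha hP) (hP5_of_V1 hP) hLM hRM hθ hcf hw hwb hD3

end V1Arith

/-! ## §3  (v1.1) One size threshold: r03's `prop26_2136_kLevel_final_M` at the padded family -/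

section Budget

open Classical in
/-- **PROPOSITION 2.6 (2.136)₁ AT k LEVELS, EVERY ODD `L ≥ 5`, ONE SIZE THRESHOLD** — r03's v1.5 `prop26_2136_kLevel_final_M` (for `α > 0` the Lemma-2.1
exponent `N₀` is chosen inside; the budget hypotheses collapse to `M₂ ≤ L·M_h`) at the padded family `padT D`, transported back to `D` exactly as in
`prop26_2136_kLevel_final_pad_le`: no placement hypothesis, only the line-3 majorant (iv) displayed, rate `delta3 α (2σ)` for any `σ ≤ σ₀`.
[cite: Balaban1984PropagatorsII, Prop. 2.6 (2.136) p.247, (2.133)–(2.135) p.247, (2.88)–(2.94) pp.238–239, (2.36) p.229, (2.1)–(2.4) p.224, Lemma 2.1 p.234] -/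
theorem prop26_2136_kLevel_final_pad_M (d ℓ : ℕ) (hd : 1 ≤ d + 1) (hL : Odd (ℓ + 1) ∧ 1 < ℓ + 1) {b₀ b₁ : ℝ} (hb₀ : 0 < b₀) (hb₁ : b₀ ≤ b₁) :
    ∃ σ₀ : ℝ, 0 < σ₀ ∧ ∀ (σ : ℝ), 0 < σ → σ ≤ σ₀ → ∀ (α : ℝ), 0 < α → α ≤ 1 → ∀ {CD cD : ℝ}, 0 ≤ CD → 0 < cD →
    ∃ A M₂ : ℝ, 0 ≤ A ∧ 0 < M₂ ∧
    ∀ (m K : ℕ) {Mh k R : ℕ} {P' P'' : Fin (d + 1) → ℕ}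
      (hN : ∀ μ, N0 ℓ Mh k P' μ = (PV d ℓ m K hd hL).sitesPerDir 0) (D : B6MultiLevelTorusOperatorL0.TDomains d ℓ Mh k P' R) (hk : k ≤ m + K) (hk' : k + 1 ≤ m + K) (_ : 1 ≤ k)
      {a : ℕ} (hMha : Mh = (ℓ + 1) ^ a) (hM8 : 8 ≤ Mh) (_ : 2 * (ℓ + 1) ^ 2 ≤ R)
      (hLP : ∀ μ, P' μ = (ℓ + 1) * P'' μ) (hP5 : ∀ μ, 5 ≤ P'' μ)
      (_ : M₂ ≤ ((ℓ : ℝ) + 1) * Mh)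
      {cf : ℝ} (hcf : cf ≠ 0) {w : BondIdx (domT hN D hk) → ℝ} (hw : ∀ i, 0 < w i) (_ : GlobalBand b₀ b₁ cf w)
      (_ : ∀ c : ↥(cubes (padT D hLP).toDomains), HasMajorant (g := geomTB (padT D hLP)) (blkV1 (hN_pad hN hLP) (padT D hLP))
        (mulOp (zB (hN_pad hN hLP) (padT D hLP) (one_le_of_eight_le hM8) (four_le_of_five_le hP5) c) *
          (onFun (dE (P := PV d ℓ m K hd hL) cf ∘ₗ (LinearMap.id - RE (domT (hN_pad hN hLP) (padT D hLP) hk') cf) ∘ₗ dsE cf) -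
            Pl (hN_pad hN hLP) hk' (one_le_of_eight_le hM8) (four_le_of_five_le hP5) hMha c (band_le (d := d) (ℓ := ℓ) hb₀ hb₁)
              (placed_pad D hLP hP5 c) (w ∘ (sameOm_domT_pad hN D hk hLP hk').idxB) cf) *
          mulOp (hB (hN_pad hN hLP) (padT D hLP) c))
        (fun y y'' => CD * cf ^ 2 * Real.exp (-(cD * (geomTB (padT D hLP)).M)) / (geomTB (padT D hLP)).len y ^ 2 *
          Real.exp (-((2 * σ) * (geomTB (padT D hLP)).dist y y'')))),
      HasMajorant (g := geomT D) (blkV1 hN D) (onFun (GE (domT hN D hk) hcf hw))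
        (fun y y' => A * pref cf y * Real.exp (-(delta3 α (2 * σ) * (geomT D).dist y y'))) := by
  obtain ⟨σ₀, hσ₀, h⟩ := B6Prop26KLevelAssemblyV1L3.prop26_2136_kLevel_final_M d ℓ hd hL hb₀ hb₁
  refine ⟨σ₀, hσ₀, fun σ hσ0 hσle α hα0 hα1 CD cD hCD hcD => ?_⟩
  obtain ⟨A, M₂, hA, hM₂, h2⟩ := h σ hσ0 hσle α hα0 hα1 hCD hcD
  refine ⟨A, M₂, hA, hM₂, ?_⟩
  intro m K Mh k R P' P'' hN D hk hk' hk1 a hMha hM8 hR2 hLP hP5 hLM cf hcf w hw hwb hD3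
  have hS := sameOm_domT_pad hN D hk hLP hk'
  have hw' : ∀ i, 0 < (w ∘ hS.idxB) i := fun i => hw _
  have hpad := h2 m K (hN_pad hN hLP) (padT D hLP) hk' (by omega) hMha hM8 hR2 hP5 (placed_pad D hLP hP5) hLM hcf hw'
    (globalBand_pad D hLP hN hk hk' hwb) hD3
  rw [hS.GE_eq hcf hw hw'] at hpad
  have hK : (fun a b : (geomT D).Site => A * pref cf (D := padT D hLP) (eT D hLP a) *
      Real.exp (-(delta3 α (2 * σ) * (geomT (padT D hLP)).dist (eT D hLP a) (eT D hLP b)))) =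
      fun y y' => A * pref cf y * Real.exp (-(delta3 α (2 * σ) * (geomT D).dist y y')) := by
    funext a b
    rw [dist_eT, pref_eT]
  rw [← hK]
  exact hasMajorant_of_pad D hLP hN hpad

open Classical in
/-- **THE SAME STATED ON THE ORIGINAL DATA** (`P″ := P′/L`, `hLP`, `P″ ≥ 5`, `k + 1 ≤ m + K` derived from `hN`, `M_h = L^a`, `P′ ≥ 5L` as in
`prop26_2136_kLevel_final_pad_le_V1`): every odd `L ≥ 5`, `α > 0`, one size threshold `M₂ ≤ L·M_h`, only the line-3 majorant (iv) displayed.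
[cite: Balaban1984PropagatorsII, Prop. 2.6 (2.136) p.247, (2.133)–(2.135) p.247, (2.88)–(2.94) pp.238–239, (2.36) p.229, (2.1)–(2.4) p.224, Lemma 2.1 p.234] -/
theorem prop26_2136_kLevel_final_pad_M_V1 (d ℓ : ℕ) (hd : 1 ≤ d + 1) (hL : Odd (ℓ + 1) ∧ 1 < ℓ + 1) {b₀ b₁ : ℝ} (hb₀ : 0 < b₀) (hb₁ : b₀ ≤ b₁) :
    ∃ σ₀ : ℝ, 0 < σ₀ ∧ ∀ (σ : ℝ), 0 < σ → σ ≤ σ₀ → ∀ (α : ℝ), 0 < α → α ≤ 1 → ∀ {CD cD : ℝ}, 0 ≤ CD → 0 < cD →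
    ∃ A M₂ : ℝ, 0 ≤ A ∧ 0 < M₂ ∧
    ∀ (m K : ℕ) {Mh k R : ℕ} {P' : Fin (d + 1) → ℕ}
      (hN : ∀ μ, N0 ℓ Mh k P' μ = (PV d ℓ m K hd hL).sitesPerDir 0) (D : B6MultiLevelTorusOperatorL0.TDomains d ℓ Mh k P' R) (hk : k ≤ m + K) (_ : 1 ≤ k)
      {a : ℕ} (hMha : Mh = (ℓ + 1) ^ a) (hM8 : 8 ≤ Mh) (_ : 2 * (ℓ + 1) ^ 2 ≤ R) (hP : ∀ μ, 5 * (ℓ + 1) ≤ P' μ)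
      (_ : M₂ ≤ ((ℓ : ℝ) + 1) * Mh)
      {cf : ℝ} (hcf : cf ≠ 0) {w : BondIdx (domT hN D hk) → ℝ} (hw : ∀ i, 0 < w i) (_ : GlobalBand b₀ b₁ cf w)
      (_ : ∀ c : ↥(cubes (padT D (hLP_of_V1 hN hMha hP)).toDomains),
        HasMajorant (g := geomTB (padT D (hLP_of_V1 hN hMha hP))) (blkV1 (hN_pad hN (hLP_of_V1 hN hMha hP)) (padT D (hLP_of_V1 hN hMha hP)))
        (mulOp (zB (hN_pad hN (hLP_of_V1 hN hMha hP)) (padT D (hLP_of_V1 hN hMha hP)) (one_le_of_eight_le hM8)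
            (four_le_of_five_le (hP5_of_V1 hP)) c) *
          (onFun (dE (P := PV d ℓ m K hd hL) cf ∘ₗ
              (LinearMap.id - RE (domT (hN_pad hN (hLP_of_V1 hN hMha hP)) (padT D (hLP_of_V1 hN hMha hP)) (hk'_of_V1 hN hMha hP)) cf) ∘ₗ dsE cf) -
            Pl (hN_pad hN (hLP_of_V1 hN hMha hP)) (hk'_of_V1 hN hMha hP) (one_le_of_eight_le hM8) (four_le_of_five_le (hP5_of_V1 hP)) hMha c
              (band_le (d := d) (ℓ := ℓ) hb₀ hb₁) (placed_pad D (hLP_of_V1 hN hMha hP) (hP5_of_V1 hP) c)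
              (w ∘ (sameOm_domT_pad hN D hk (hLP_of_V1 hN hMha hP) (hk'_of_V1 hN hMha hP)).idxB) cf) *
          mulOp (hB (hN_pad hN (hLP_of_V1 hN hMha hP)) (padT D (hLP_of_V1 hN hMha hP)) c))
        (fun y y'' => CD * cf ^ 2 * Real.exp (-(cD * (geomTB (padT D (hLP_of_V1 hN hMha hP))).M)) /
          (geomTB (padT D (hLP_of_V1 hN hMha hP))).len y ^ 2 * Real.exp (-((2 * σ) * (geomTB (padT D (hLP_of_V1 hN hMha hP))).dist y y'')))),
      HasMajorant (g := geomT D) (blkV1 hN D) (onFun (GE (domT hN D hk) hcf hw))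
        (fun y y' => A * pref cf y * Real.exp (-(delta3 α (2 * σ) * (geomT D).dist y y'))) := by
  obtain ⟨σ₀, hσ₀, h⟩ := prop26_2136_kLevel_final_pad_M d ℓ hd hL hb₀ hb₁
  refine ⟨σ₀, hσ₀, fun σ hσ0 hσle α hα0 hα1 CD cD hCD hcD => ?_⟩
  obtain ⟨A, M₂, hA, hM₂, h2⟩ := h σ hσ0 hσle α hα0 hα1 hCD hcD
  refine ⟨A, M₂, hA, hM₂, ?_⟩
  intro m K Mh k R P' hN D hk hk1 a hMha hM8 hR2 hP hLM cf hcf w hw hwb hD3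
  exact h2 m K hN D hk (hk'_of_V1 hN hMha hP) hk1 hMha hM8 hR2 (hLP_of_V1 hN hMha hP) (hP5_of_V1 hP) hLM hcf hw hwb hD3

end Budget

end

end Literature.MathematicalPhysics.QuantumFieldTheory.Balaban1983to89.B6Prop26KLevelAssemblyPadV1L3
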